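import Mathlib.RepresentationTheory.Subrepresentation
import Mathlib.Tactic.FinCases
import Mathlib.Tactic.LinearCombination
import Mathlib.Tactic.NormNum
import HarnessLib

/-!
# A plane representation containing two opposite transvections is irreducible (over a field-like coefficient ring)
# — the representation-theoretic core of «`ρ̄_{E,p}(G_ℚ) = GL₂(𝔽_p)` ⟹ `ρ̄_{g_m}|_{G_K}` irreducible» (helper,
# `--supports stmt-BirchSwinnertonDyer-23253`)

Cell `bsd-stepL`, seat `bsd-stepL-imc-p1` (prover g27, 2026-08-28). Theorems only (no definition, no named fact, no
`sorry`, no instance, no notation). Part 1 of the bridge «`Surj W p` ⟹ hypothesis (i) of the erratum's Thm. 2.3 for every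
Hida member» (`RAMFREE-REKEY-PROPOSAL.md` §5: the conjunct
`IsSimpleOrder (Subrepresentation ((residualRep D.Δ).comp (absGaloisRestrict ℚ K)))` of F3♯‡, to be DERIVED rather than cited).

`isSimpleOrder_subrepresentation_of_transvections` — PURE ALGEBRA: let `k` be a non-trivial commutative ring in which every
non-zero element is a unit, `π` a representation of a monoid `G` on `k²`, and suppose there are vectors `v₁ ≠ 0`, `v₂` and
elements `g₁, g₂ ∈ G` acting as opposite transvections (only `v₁ ≠ 0` is needed), `π(g₁) v₁ = v₁`, `π(g₁) v₂ = v₂ + c v₁`, `π(g₂) v₁ = v₁ + c v₂`,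
`π(g₂) v₂ = v₂`, with `c ∈ kˣ`. Then `π` is irreducible (`IsSimpleOrder (Subrepresentation π)`): `v₁, v₂` are independent
(apply `π(g₁) − 1`, `π(g₂) − 1`), hence a basis of `k²` (the determinant is a unit), and a non-zero stable submodule containing
`s v₁ + t v₂` contains `t c v₁` and `s c v₂`, hence `v₁` and `v₂`. Used (part 3, `ErratumRoadFiveSurjIrrK.lean`) with
`k = 𝒪/ϖ`, `π = ρ̄_{g_m} ∘ res_K`, `g_i = σ_i²` for `σ_i ∈ Γ_ℚ` acting on `E[p]` as elementary transvections (squares lie in the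
index-two subgroup `Γ_K`), `c = 2`.

HONEST FRAMING: elementary linear algebra; nothing about BSD for any pair; closes: none (T7).

## References
* [Serre1972] §2.4–§2.6 (subgroups of `GL₂(𝔽_p)`; a subgroup containing two non-commuting transvections contains `SL₂(𝔽_p)` and
  acts irreducibly).
* [Castella2018Erratum] Thm. 2.3 (i) (p. 3) and footnote 1 (p. 4) (the hypothesis this serves).
-/

set_option autoImplicit false
-- D-0017: single-problem summit, the namespace repeats the problem name by design.
set_option linter.dupNamespace false

namespace Summit.BirchSwinnertonDyer.BirchSwinnertonDyer.Theorems.SurjIrrK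

/-- **Two opposite transvections on non-zero vectors make a plane representation irreducible.** For a non-trivial commutative
ring `k` all of whose non-zero elements are units, a representation `π` of a monoid `G` on `k²`, vectors `v₁ ≠ 0`, `v₂` of `k²`,
`c ∈ kˣ` and `g₁ g₂ ∈ G` with `π g₁ v₁ = v₁`, `π g₁ v₂ = v₂ + c • v₁`, `π g₂ v₁ = v₁ + c • v₂`, `π g₂ v₂ = v₂`: the only
subrepresentations of `π` are `⊥` and `⊤`. [cite: Serre1972, §2.4–§2.6 (a subgroup of `GL₂(𝔽_p)` containing two non-commuting transvections acts irreducibly)] -/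
theorem isSimpleOrder_subrepresentation_of_transvections {k : Type*} [CommRing k] [Nontrivial k]
    (hk : ∀ x : k, x ≠ 0 → IsUnit x) {G : Type*} [Monoid G]
    (π : Representation k G (Fin 2 → k)) (g₁ g₂ : G) {c : k} (hc : IsUnit c)
    {v₁ v₂ : Fin 2 → k} (hv₁ : v₁ ≠ 0)
    (h₁₁ : π g₁ v₁ = v₁) (h₁₂ : π g₁ v₂ = v₂ + c • v₁)
    (h₂₁ : π g₂ v₁ = v₁ + c • v₂) (h₂₂ : π g₂ v₂ = v₂) :
    IsSimpleOrder (Subrepresentation π) := by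
  classical
  -- `k` has no zero divisors
  have hmul0 : ∀ a b : k, a * b = 0 → a ≠ 0 → b = 0 := fun a b hab ha ↦ by
    obtain ⟨u, rfl⟩ := hk a ha
    calc b = ((u⁻¹ : kˣ) : k) * ((u : k) * b) := by rw [← mul_assoc, Units.inv_mul, one_mul]
      _ = 0 := by rw [hab, mul_zero]
  have hsmul0 : ∀ (a : k) (w : Fin 2 → k), a • w = 0 → w ≠ 0 → a = 0 := fun a w haw hw ↦ by
    obtain ⟨i, hi⟩ := Function.ne_iff.1 hw
    have h : a * w i = 0 := by simpa using congrFun haw i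
    exact hmul0 (w i) a (by rwa [mul_comm]) hi
  have hcu : ∀ t : k, t * c = 0 → t = 0 := fun t ht ↦ by
    obtain ⟨u, rfl⟩ := hc
    calc t = t * (u : k) * ((u⁻¹ : kˣ) : k) := by rw [mul_assoc, Units.mul_inv, mul_one]
      _ = 0 := by rw [ht, zero_mul]
  -- the transvections on combinations
  have hT₁ : ∀ s t : k, π g₁ (s • v₁ + t • v₂) = (s • v₁ + t • v₂) + (t * c) • v₁ := fun s t ↦ by
    rw [map_add, map_smul, map_smul, h₁₁, h₁₂, smul_add, mul_smul]; abel
  have hT₂ : ∀ s t : k, π g₂ (s • v₁ + t • v₂) = (s • v₁ + t • v₂) + (s * c) • v₂ := fun s t ↦ by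
    rw [map_add, map_smul, map_smul, h₂₁, h₂₂, smul_add, mul_smul]; abel
  -- independence of `v₁, v₂`
  have hind : ∀ s t : k, s • v₁ + t • v₂ = 0 → s = 0 ∧ t = 0 := fun s t hst ↦ by
    have ht : t = 0 := by
      have h := hT₁ s t
      rw [hst, map_zero, zero_add] at h
      exact hcu t (hsmul0 _ _ h.symm hv₁)
    have hs : s = 0 := by
      rw [ht, zero_smul, add_zero] at hst
      exact hsmul0 _ _ hst hv₁
    exact ⟨hs, ht⟩
  -- `v₁, v₂` span `k²`: the determinant is non-zero, hence a unit
  set a := v₁ 0 with ha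
  set b := v₁ 1 with hb
  set a' := v₂ 0 with ha'
  set b' := v₂ 1 with hb'
  have hδ : a * b' - b * a' ≠ 0 := by
    intro hδ
    have e₁ : b' • v₁ + (-b) • v₂ = 0 := by
      funext i; fin_cases i
      · simp only [Pi.add_apply, Pi.smul_apply, smul_eq_mul, Pi.zero_apply, Fin.zero_eta]
        linear_combination hδ
      · simp only [Pi.add_apply, Pi.smul_apply, smul_eq_mul, Pi.zero_apply, Fin.mk_one]
        ring
    have e₂ : (-a') • v₁ + a • v₂ = 0 := by
      funext i; fin_cases i
      · simp only [Pi.add_apply, Pi.smul_apply, smul_eq_mul, Pi.zero_apply, Fin.zero_eta]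
        ring
      · simp only [Pi.add_apply, Pi.smul_apply, smul_eq_mul, Pi.zero_apply, Fin.mk_one]
        linear_combination hδ
    obtain ⟨hb'0, hb0⟩ := hind _ _ e₁
    obtain ⟨ha'0, ha0⟩ := hind _ _ e₂
    apply hv₁
    funext i; fin_cases i
    · exact ha0
    · exact neg_eq_zero.1 hb0
  obtain ⟨u, hu⟩ := hk _ hδ
  have hspan : ∀ w : Fin 2 → k, ∃ s t : k, w = s • v₁ + t • v₂ := fun w ↦ by
    refine ⟨((u⁻¹ : kˣ) : k) * (b' * w 0 - a' * w 1), ((u⁻¹ : kˣ) : k) * (a * w 1 - b * w 0), ?_⟩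
    have hui : ((u⁻¹ : kˣ) : k) * (a * b' - b * a') = 1 := by rw [← hu, Units.inv_mul]
    funext i; fin_cases i
    · simp only [Pi.add_apply, Pi.smul_apply, smul_eq_mul, Fin.zero_eta]
      linear_combination (-(w 0)) * hui
    · simp only [Pi.add_apply, Pi.smul_apply, smul_eq_mul, Fin.mk_one]
      linear_combination (-(w 1)) * hui
  -- unit scalars can be cancelled inside a submodule
  have hunit : ∀ (L : Submodule k (Fin 2 → k)) (x : k) (w : Fin 2 → k), IsUnit x → x • w ∈ L → w ∈ L :=
    fun L x w hx hxw ↦ by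
      obtain ⟨u', rfl⟩ := hx
      have h := L.smul_mem ((u'⁻¹ : kˣ) : k) hxw
      rwa [smul_smul, Units.inv_mul, one_smul] at h
  -- `⊥ ≠ ⊤`
  haveI : Nontrivial (Subrepresentation π) := ⟨⟨⊥, ⊤, fun hbt ↦ hv₁ <| by
    have h : v₁ ∈ (⊥ : Subrepresentation π).toSubmodule := by
      rw [hbt]; exact Submodule.mem_top
    exact (Submodule.mem_bot k).1 h⟩⟩
  refine ⟨fun L ↦ ?_⟩
  by_cases hL : L.toSubmodule = ⊥
  · exact Or.inl (Subrepresentation.toSubmodule_injective hL)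
  · right
    obtain ⟨v, hvL, hv0⟩ := (Submodule.ne_bot_iff _).1 hL
    obtain ⟨s, t, rfl⟩ := hspan v
    -- `t c v₁ ∈ L` and `s c v₂ ∈ L`
    have hm₁ : (t * c) • v₁ ∈ L.toSubmodule := by
      have h := L.toSubmodule.sub_mem (L.apply_mem_toSubmodule g₁ hvL) hvL
      rwa [hT₁, add_sub_cancel_left] at h
    have hm₂ : (s * c) • v₂ ∈ L.toSubmodule := by
      have h := L.toSubmodule.sub_mem (L.apply_mem_toSubmodule g₂ hvL) hvL
      rwa [hT₂, add_sub_cancel_left] at h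
    -- both basis vectors lie in `L`
    have hboth : v₁ ∈ L.toSubmodule ∧ v₂ ∈ L.toSubmodule := by
      by_cases ht : t = 0
      · have hs : s ≠ 0 := by
          rintro rfl
          rw [ht, zero_smul, zero_smul, add_zero] at hv0
          exact hv0 rfl
        have hv₂L : v₂ ∈ L.toSubmodule := hunit _ _ _ ((hk s hs).mul hc) hm₂
        have hcv₁ : c • v₁ ∈ L.toSubmodule := by
          have h := L.toSubmodule.sub_mem (L.apply_mem_toSubmodule g₁ hv₂L) hv₂L
          rwa [h₁₂, add_sub_cancel_left] at h
        exact ⟨hunit _ _ _ hc hcv₁, hv₂L⟩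
      · have hv₁L : v₁ ∈ L.toSubmodule := hunit _ _ _ ((hk t ht).mul hc) hm₁
        have hcv₂ : c • v₂ ∈ L.toSubmodule := by
          have h := L.toSubmodule.sub_mem (L.apply_mem_toSubmodule g₂ hv₁L) hv₁L
          rwa [h₂₁, add_sub_cancel_left] at h
        exact ⟨hv₁L, hunit _ _ _ hc hcv₂⟩
    apply Subrepresentation.toSubmodule_injective
    change L.toSubmodule = ⊤
    refine eq_top_iff.2 fun w _ ↦ ?_
    obtain ⟨s', t', rfl⟩ := hspan w
    exact L.toSubmodule.add_mem (L.toSubmodule.smul_mem _ hboth.1) (L.toSubmodule.smul_mem _ hboth.2)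

end Summit.BirchSwinnertonDyer.BirchSwinnertonDyer.Theorems.SurjIrrK
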